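import Summits.QuantumFields.BalabanUV.T4Continuum.Support.VariationalColourTaxiTower

/-!
# T⁴ programme, spine node NE2 (U1a), lane P2 — SUPPLIER ITEM «V-COL-TWO-RUNS», file 3: TWO OPERATOR TAXI TOWERS — the TRANSPORT side of the two-run class at taxi
# data reduces to BOND-FIELD DISTANCES: straight transporters, taxis, coarsenings and the NESTED taxi frames of two towers of contractive one-step bond operators differ
# by at most (number of bonds on the contour) × (sup bond distance), summed over the levels of the nesting
# (the operator twin of leaf-09-g5's U(1) contour telescoping `VariationalCovariantTwoRunsTransport.norm_nestOf_sub_nestOf_le`; model level; cell `pub-balaban`)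

NE2 formalisation swarm `b2b-balaban-t4-ne2-formalise-*`, leaf prover 02 (gen 6); register P2-sup, item «V-COL-TWO-RUNS» (INTENT CLAIMS.log l.17982, addendum).  On top of
leaf-04-g4's operator taxi dictionary (`piTv`, `legTv`, `taxiAcc`, `taxiTv`, `coarseTv`, `nestTv`, `compTv`; p219320 ∕ p222225) and `VariationalVectorFederbush.norm_mul_sub_mul_le`
BY NAME; nothing defined.
WHY.  File 2's two-runs END `towerLimitRate_colourTwoRuns_closed_local` displays the TWO-RUN CLASS `‖Rb k y μ − Rc k y μ‖ ≤ ρ_k`, `‖Tb k x − T k x‖ ≤ τ_k` (node NE3's currency).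
At taxi data the site operators are NESTED taxi frames and the bond operators straight coarsenings, so `τ_k` and `ρ_k` are NOT primary: they follow from the distances of the
two runs' ONE-STEP BOND FIELDS level by level — which is what an NE3-type statement supplies.  THIS FILE is that reduction:
 * §1 `norm_piTv_sub_piTv_le` (`‖Π^μ_t(R₁) − Π^μ_t(R₂)‖ ≤ t·ρ`), `norm_legTv_sub_legTv_le` (`≤ (L−1)·ρ`), `norm_taxiAcc_sub_taxiAcc_le` (`≤ i·(L−1)·ρ`),
   **`norm_taxiTv_sub_taxiTv_le`** (`‖taxiTv R₁ x − taxiTv R₂ x‖ ≤ d·(L−1)·ρ`), **`norm_coarseTv_sub_coarseTv_le`** (`‖coarseTv R₁ y μ − coarseTv R₂ y μ‖ ≤ L·ρ`) — for contractive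
   bond operators with `‖R₁ x μ − R₂ x μ‖ ≤ ρ`, `0 ≤ ρ`;
 * §2 `norm_compTv_sub_compTv_le` (composites of contractions: `≤ τ + τ′`) and **`norm_nestTv_sub_nestTv_le`**: for two towers of contractive one-step bond operators with
   level-`j` sup distances `ρ j ≥ 0`, `‖nestTv R′₁ k x − nestTv R′₂ k x‖ ≤ Σ_{j<k} d·(L−1)·ρ j` — the `τ_k` of file 2 at taxi data, and `norm_Rlev_sub_Rlev_le` (`≤ L·ρ_{k−1}`,
   resp. `L·ρ 0` at level 0) — the `ρ_k` of file 2 at taxi data, both from bond-field distances only (what a colour NE3 adapter would bound — NOT done here).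
WHAT IS NOT HERE (stated, not hidden): any NE3 statement or adapter; the two-runs END at taxi data itself (left to the consumer: run k's UB⁺∕P⁺ in leaf shape are one-liners
of «V-COL-TAXI-0FORM-END»); 1-forms.

HONEST FRAMING (T4-DAG p. 1).  Ordered-product bookkeeping at MODEL level (bond operators DATA on a normed ℂ-space; taxi ∕ straight contours OURS; [Balaban1985BackgroundPropagators]
(3.10) ∕ (3.15) ∕ (3.19) SHAPES only, no B0, c5); [folklore]; nothing printed is a hypothesis; no `def`, no `def … : Prop`, no `sorry`; axioms standard.  NE2 NOT proved on
either road; NE3 OPEN; spine PROVED 0∕9 unchanged; rung (B)+1 finite T⁴ — NOT infinite volume, NOT mass gap, NOT Clay.  HONEST DEPENDENCY (cell, verbatim): continuum YM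
on T⁴ ⇐ BetaPertH ∧ nine spine estimates (0/9 proved); BetaPertH ⇐ (D1) ∧ (D4) ∧ CAP+tail; G-an2-4 gates asym, D1 and NE2/3/4.
-/

noncomputable section

namespace Summit.QuantumFields.BalabanUV.T4Continuum.VariationalColourTaxiTwoTowers

open Finset
open Literature.MathematicalPhysics.QuantumFieldTheory.Balaban1983to89
open Literature.MathematicalPhysics.QuantumFieldTheory.Balaban1983to89.B5Prop11Plancherel (Tor fine unitVec)
open Literature.MathematicalPhysics.QuantumFieldTheory.Balaban1983to89.B5Block118 (tstep bpt)
open Literature.MathematicalPhysics.QuantumFieldTheory.Balaban1983to89.B5Blocks16 (blockOf)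
open Literature.MathematicalPhysics.QuantumFieldTheory.Balaban1983to89.B5Composition116 (sites)
open Summit.QuantumFields.BalabanUV.T4Continuum.VariationalColourFederbush (piTv norm_piTv_le_one)
open Summit.QuantumFields.BalabanUV.T4Continuum.VariationalColourTower (compTv Rtrv)
open Summit.QuantumFields.BalabanUV.T4Continuum.VariationalVectorFederbush (norm_mul_sub_mul_le)
open Summit.QuantumFields.BalabanUV.T4Continuum.VariationalColourTaxiTransport

variable {d : ℕ} {E : Type*} [NormedAddCommGroup E] [NormedSpace ℂ E]

/-! ## §1 One block step: straight transporters, legs, taxis, coarsenings of two bond fields -/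

section OneStep

variable (L : ℕ) [NeZero L] (N : Fin d → ℕ) [hN : ∀ μ, NeZero (N μ)]
variable {R₁ R₂ : Tor (fine L N) → Fin d → (E →L[ℂ] E)} (h₁ : ∀ x μ, ‖R₁ x μ‖ ≤ 1) (h₂ : ∀ x μ, ‖R₂ x μ‖ ≤ 1) {ρ : ℝ} (hρ0 : 0 ≤ ρ)
  (hρ : ∀ x μ, ‖R₁ x μ - R₂ x μ‖ ≤ ρ)
include h₁ h₂ hρ0 hρ

omit [NeZero L] hN in
/-- straight transporters of `t` bonds differ by `≤ t·ρ`. [folklore] -/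
theorem norm_piTv_sub_piTv_le (x : Tor (fine L N)) (μ : Fin d) : ∀ t : ℕ, ‖piTv L N R₁ x μ t - piTv L N R₂ x μ t‖ ≤ t * ρ
  | 0 => by simp [piTv]
  | t + 1 => by
    have ih := norm_piTv_sub_piTv_le x μ t
    calc ‖piTv L N R₁ x μ (t + 1) - piTv L N R₂ x μ (t + 1)‖
        = ‖piTv L N R₁ x μ t * R₁ (x + tstep (fine L N) μ t) μ - piTv L N R₂ x μ t * R₂ (x + tstep (fine L N) μ t) μ‖ := by simp only [piTv]
      _ ≤ ‖piTv L N R₁ x μ t - piTv L N R₂ x μ t‖ * ‖R₁ (x + tstep (fine L N) μ t) μ‖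
          + ‖piTv L N R₂ x μ t‖ * ‖R₁ (x + tstep (fine L N) μ t) μ - R₂ (x + tstep (fine L N) μ t) μ‖ := norm_mul_sub_mul_le _ _ _ _
      _ ≤ t * ρ * 1 + 1 * ρ :=
          add_le_add (mul_le_mul ih (h₁ _ _) (norm_nonneg _) (by positivity))
            (mul_le_mul (norm_piTv_le_one L N h₂ _ _ _) (hρ _ _) (norm_nonneg _) zero_le_one)
      _ = ((t + 1 : ℕ) : ℝ) * ρ := by push_cast; ring

omit hN in
/-- taxi legs differ by `≤ (L−1)·ρ` (a leg has at most `L − 1` bonds). [folklore] -/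
theorem norm_legTv_sub_legTv_le (y : Tor N) (j : Fin d → Fin L) (i : ℕ) :
    ‖legTv L N R₁ y j i - legTv L N R₂ y j i‖ ≤ ((L - 1 : ℕ) : ℝ) * ρ := by
  unfold legTv
  split_ifs with h
  · refine (norm_piTv_sub_piTv_le L N h₁ h₂ hρ0 hρ _ _ _).trans ?_
    have hj : ((j ⟨i, h⟩ : ℕ) : ℝ) ≤ ((L - 1 : ℕ) : ℝ) := by
      have := (j ⟨i, h⟩).is_lt; exact_mod_cast (by omega)
    exact mul_le_mul_of_nonneg_right hj hρ0
  · rw [sub_self, norm_zero]; positivity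

omit hN in
/-- accumulated taxis of `i` legs differ by `≤ i·(L−1)·ρ`. [folklore] -/
theorem norm_taxiAcc_sub_taxiAcc_le (y : Tor N) (j : Fin d → Fin L) :
    ∀ i : ℕ, ‖taxiAcc L N R₁ y j i - taxiAcc L N R₂ y j i‖ ≤ i * (((L - 1 : ℕ) : ℝ) * ρ)
  | 0 => by simp [taxiAcc]
  | i + 1 => by
    have ih := norm_taxiAcc_sub_taxiAcc_le y j i
    calc ‖taxiAcc L N R₁ y j (i + 1) - taxiAcc L N R₂ y j (i + 1)‖
        = ‖taxiAcc L N R₁ y j i * legTv L N R₁ y j i - taxiAcc L N R₂ y j i * legTv L N R₂ y j i‖ := by simp only [taxiAcc]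
      _ ≤ ‖taxiAcc L N R₁ y j i - taxiAcc L N R₂ y j i‖ * ‖legTv L N R₁ y j i‖
          + ‖taxiAcc L N R₂ y j i‖ * ‖legTv L N R₁ y j i - legTv L N R₂ y j i‖ := norm_mul_sub_mul_le _ _ _ _
      _ ≤ i * (((L - 1 : ℕ) : ℝ) * ρ) * 1 + 1 * (((L - 1 : ℕ) : ℝ) * ρ) :=
          add_le_add (mul_le_mul ih (norm_legTv_le_one L N h₁ y j i) (norm_nonneg _) (by positivity))
            (mul_le_mul (norm_taxiAcc_le_one L N h₂ y j i) (norm_legTv_sub_legTv_le L N h₁ h₂ hρ0 hρ y j i) (norm_nonneg _) zero_le_one)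
      _ = ((i + 1 : ℕ) : ℝ) * (((L - 1 : ℕ) : ℝ) * ρ) := by push_cast; ring

/-- **TAXI TRANSPORTS OF TWO BOND FIELDS**: `‖taxiTv R₁ x − taxiTv R₂ x‖ ≤ d·(L−1)·ρ`. [folklore] -/
theorem norm_taxiTv_sub_taxiTv_le (x : Tor (fine L N)) : ‖taxiTv L N R₁ x - taxiTv L N R₂ x‖ ≤ d * (((L - 1 : ℕ) : ℝ) * ρ) :=
  norm_taxiAcc_sub_taxiAcc_le L N h₁ h₂ hρ0 hρ _ _ d

omit hN in
/-- **STRAIGHT COARSENINGS OF TWO BOND FIELDS**: `‖coarseTv R₁ y μ − coarseTv R₂ y μ‖ ≤ L·ρ`. [folklore] -/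
theorem norm_coarseTv_sub_coarseTv_le (y : Tor N) (μ : Fin d) : ‖coarseTv L N R₁ y μ - coarseTv L N R₂ y μ‖ ≤ L * ρ :=
  norm_piTv_sub_piTv_le L N h₁ h₂ hρ0 hρ _ μ L

end OneStep

/-! ## §2 Composites and the nested taxi frames of two towers -/

section Towers

variable (n L : ℕ) [NeZero n] [NeZero L] (M : Fin d → ℕ) [hM : ∀ μ, NeZero (M μ)]

/-- composites of contractions differ by at most the sum of the sup distances of their factors. [folklore] -/
theorem norm_compTv_sub_compTv_le {T₁ T₂ : Tor (fine n M) → (E →L[ℂ] E)} {T₁' T₂' : Tor (fine L (fine n M)) → (E →L[ℂ] E)}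
    (hT₁' : ∀ x, ‖T₁' x‖ ≤ 1) (hT₂ : ∀ x, ‖T₂ x‖ ≤ 1) {τ τ' : ℝ} (hτ : ∀ x, ‖T₁ x - T₂ x‖ ≤ τ) (hτ' : ∀ x, ‖T₁' x - T₂' x‖ ≤ τ')
    (x : Tor (fine (n * L) M)) : ‖compTv n L M T₁ T₁' x - compTv n L M T₂ T₂' x‖ ≤ τ + τ' := by
  unfold compTv
  calc _ ≤ ‖T₁ (blockOf L (fine n M) (sites n L M x)) - T₂ (blockOf L (fine n M) (sites n L M x))‖ * ‖T₁' (sites n L M x)‖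
        + ‖T₂ (blockOf L (fine n M) (sites n L M x))‖ * ‖T₁' (sites n L M x) - T₂' (sites n L M x)‖ := norm_mul_sub_mul_le _ _ _ _
    _ ≤ τ * 1 + 1 * τ' := by
        have hτ0 : 0 ≤ τ := (norm_nonneg _).trans (hτ (blockOf L (fine n M) (sites n L M x)))
        exact add_le_add (mul_le_mul (hτ _) (hT₁' _) (norm_nonneg _) hτ0) (mul_le_mul (hT₂ _) (hτ' _) (norm_nonneg _) zero_le_one)
    _ = τ + τ' := by ring

variable {R₁' R₂' : (k : ℕ) → Tor (fine L (fine (L ^ k) M)) → Fin d → (E →L[ℂ] E)}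
  (h₁ : ∀ k x μ, ‖R₁' k x μ‖ ≤ 1) (h₂ : ∀ k x μ, ‖R₂' k x μ‖ ≤ 1) {ρ : ℕ → ℝ} (hρ0 : ∀ k, 0 ≤ ρ k) (hρ : ∀ k x μ, ‖R₁' k x μ - R₂' k x μ‖ ≤ ρ k)
include h₁ h₂ hρ0 hρ

omit [NeZero n] in
/-- **THE NESTED TAXI FRAMES OF TWO TOWERS** differ by at most `Σ_{j<k} d·(L−1)·ρ j` (induction over `nestTv_succ` with `norm_compTv_sub_compTv_le` and the one-step taxi bound). [folklore] -/
theorem norm_nestTv_sub_nestTv_le : ∀ (k : ℕ) (x : Tor (fine (L ^ k) M)),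
    ‖nestTv L M R₁' k x - nestTv L M R₂' k x‖ ≤ ∑ j ∈ Finset.range k, (d : ℝ) * (((L - 1 : ℕ) : ℝ) * ρ j)
  | 0, x => by simp [nestTv_zero]
  | k + 1, x => by
    rw [Finset.sum_range_succ, nestTv_succ, nestTv_succ]
    exact norm_compTv_sub_compTv_le (L ^ k) L M (norm_taxiTv_le_one L (fine (L ^ k) M) (h₁ k)) (norm_nestTv_le_one L M h₂ k)
      (fun y => norm_nestTv_sub_nestTv_le k y) (fun x' => norm_taxiTv_sub_taxiTv_le L (fine (L ^ k) M) (h₁ k) (h₂ k) (hρ0 k) (hρ k) x') x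

omit [NeZero n] hM in
/-- **THE LEVEL BONDS OF TWO TOWERS**: `‖Rlev R′₁ (k+1) x μ − Rlev R′₂ (k+1) x μ‖ ≤ ρ k` (re-indexing) and `‖Rlev R′₁ 0 y μ − Rlev R′₂ 0 y μ‖ ≤ L·ρ 0` (straight coarsening). [folklore] -/
theorem norm_Rlev_sub_Rlev_le : ∀ (k : ℕ) (x : Tor (fine (L ^ k) M)) (μ : Fin d),
    ‖Rlev L M R₁' k x μ - Rlev L M R₂' k x μ‖ ≤ (L : ℝ) * (Nat.rec (ρ 0) (fun j _ => ρ j) k)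
  | 0, x, μ => norm_coarseTv_sub_coarseTv_le L (fine (L ^ 0) M) (h₁ 0) (h₂ 0) (hρ0 0) (hρ 0) x μ
  | k + 1, x, μ => by
    have hL1 : (1 : ℝ) ≤ L := by exact_mod_cast Nat.one_le_iff_ne_zero.mpr (NeZero.ne L)
    show ‖R₁' k (sites (L ^ k) L M x) μ - R₂' k (sites (L ^ k) L M x) μ‖ ≤ (L : ℝ) * ρ k
    exact (hρ k _ μ).trans (le_mul_of_one_le_left (hρ0 k) hL1)

end Towers

end Summit.QuantumFields.BalabanUV.T4Continuum.VariationalColourTaxiTwoTowers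

end
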